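import Mathlib.Analysis.SpecificLimits.Normed
import Summits.AnomalousDissipation.AnomalousDissipation.Theorems.SawtoothPulseCascadeK1LocalisedCascadeBlockBudget
import Summits.AnomalousDissipation.AnomalousDissipation.Theorems.SawtoothPulseCascadeK1LocalisedCascadeBlockJunk
import Summits.AnomalousDissipation.AnomalousDissipation.Theorems.SawtoothPulseCascadeK1LocalisedCascadeBlockSum

/-!
# K1loc, line `Spectral` / thin start — helper: THE BLOCK BUDGET II (sharp block sum of the junk energies; phase sums)

Helper file of the prover lane on the crux `K1LocalisedCascade` (stmt-AnomalousDissipation-19491), route `SawtoothPulseCascade`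
(glue seat; the NUMERIC LAYER of the concrete ledger assembly, part II — part I = `…BlockBudget`; companion of `…BlockJunk`).
For the block junk `J_m = r_m (ε₀^m + A_m √(2N·4d₀^m))` of `K1Window.tsum_ratioClass_{v,h}step_blocks_le` /
`tsum_strip_vstep_blocks_le` / `tsum_lowFibre_hstep_blocks_le` with the canonical envelope scale `d₀^m = 8τ_m/A_m + Mδ/(πN)`:
* §4 the envelope part EXACTLY: `(A√(2N·4d₀))² = 64NAτ + 8A²Mδ/π` (`sq_envelope_canonical`; `…BlockJunk.block_envelope_amplitude_le`
  is its `√`-subadditive form), the MINKOWSKI form of the block sum `Σ J_m² ≤ (√(Σ (r_mε_m)²) + √(Σ r_m²A_m²(2N·4d₀^m)))²`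
  (`sum_blockJunk_sq_le`) and the envelope block sum under uniform constants
  `Σ_{m<M} r_m²(64NA_mτ_m + 8A_m²Mδ/π) ≤ r²(128NAτ₀ + 8MA²Mδ/π)` (`sum_envelope_uniform_le`);
* §5 the SHARP closed form **`blockJunk_sum_le_sharp`**: same eleven hypotheses as `K1Window.blockJunk_sum_le` (`…BlockJunk`), conclusion
  `Σ_{m<M_b} J_m² ≤ (√((4/3)(r*e₀2^{M_b})²) + √(r*²(128NA*τ₀ + 8M_bA*²Mδ/π)))²` — i.e. WITHOUT the factor `3` of `blockJunk_sum_le` on the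
  kernel-layer and zone parts (they enter the energy ledger at factor `1` once the rounding allowance is negligible); amplitude form
  `√(Σ J_m²) ≤ (2/√3)r*e₀2^{M_b} + r*√(128NA*τ₀ + 8M_bA*²Mδ/π)` (`sqrt_blockJunk_sum_le_sharp`), and the Young split
  `≤ (1+t)·r*²(…) + (1+1/t)(4/3)(r*e₀2^{M_b})²` (`blockJunk_sum_le_young`);
* §6 PHASE SUMS: `4^{M_b} ≤ (2x/(Λ₀√f)+2)²` for the canonical block count of `…BlockBudget` (`four_pow_clog_le`), the geometric envelope
  block sum in the assembly's shape (`sum_range_envelope_geometric_le`), the affine–geometric series `Σ_i (a + b·i)θ^i = a/(1−θ) + bθ/(1−θ)²`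
  (`hasSum_affine_mul_geometric`, `tsum_le_of_le_affine_mul_geometric` — the `hes`/budget inputs of
  `K1Ledger.From.k1Localised_of_class_energy_ledger` when the block count grows affinely in the phase), and the phase ratio
  `N/Λ ≤ (N₀/c)(ρ/g)^j` (`div_le_mul_pow_of_le`; the kernel-layer term `128r²N_jAτ₀(j) ∝ N_j/Λ₀(j)`).
Pure real arithmetic; no definitions; no statement about the crux. [cite: Grafakos2014, Prop. 3.2.7 (3)] [problem: turb]
-/

-- `Summit.<Summit>.<Problem>`: single-conjunct summit, the duplicate namespace segment is deliberate.
set_option linter.dupNamespace false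

noncomputable section

namespace Summit.AnomalousDissipation.AnomalousDissipation.Theorems.SawtoothPulseCascade.K1Window

open Finset
open Summit.AnomalousDissipation.AnomalousDissipation.Theorems.SawtoothPulseCascade.K1Start

/-! ## §4 The per-block junk energy (exact envelope part, Minkowski block sum) -/

/-- **The envelope part of the block junk with the canonical scale, exactly**: for `A, N > 0` and `d₀ = 8τ/A + Mδ/(πN)`,
`(A·√(2N·4d₀))² = 64·N·A·τ + 8·A²·Mδ/π` (`τ, Mδ ≥ 0`). [folklore] -/
theorem sq_envelope_canonical {A N τ Mδ : ℝ} (hA : 0 < A) (hN : 0 < N) (hτ : 0 ≤ τ) (hMδ : 0 ≤ Mδ) :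
    (A * Real.sqrt (2 * N * (4 * (8 * τ / A + Mδ / (Real.pi * N))))) ^ 2 = 64 * N * A * τ + 8 * A ^ 2 * Mδ / Real.pi := by
  have hπ : 0 < Real.pi := Real.pi_pos
  have h0 : 0 ≤ 2 * N * (4 * (8 * τ / A + Mδ / (Real.pi * N))) := by positivity
  rw [mul_pow, Real.sq_sqrt h0]
  field_simp
  ring

/-- **THE BLOCK SUM OF THE JUNK ENERGIES, MINKOWSKI FORM** (sharp in the main term): with `J_m = r_m(ε_m + A_m√(2N·4d₀^m))`,
`r_m, ε_m, A_m ≥ 0`, `N·d₀^m ≥ 0`:  `Σ_{m∈s} J_m² ≤ (√(Σ_{m∈s} (r_mε_m)²) + √(Σ_{m∈s} r_m²A_m²·(2N·4d₀^m)))²`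
(`K1Start.sum_le_sq_sqrt_add_sqrt`). [folklore] -/
theorem sum_blockJunk_sq_le (s : Finset ℕ) {r ε A d₀ : ℕ → ℝ} {N : ℝ} (hr : ∀ m ∈ s, 0 ≤ r m) (hε : ∀ m ∈ s, 0 ≤ ε m)
    (hA : ∀ m ∈ s, 0 ≤ A m) (hd : ∀ m ∈ s, 0 ≤ 2 * N * (4 * d₀ m)) :
    ∑ m ∈ s, (r m * (ε m + A m * Real.sqrt (2 * N * (4 * d₀ m)))) ^ 2 ≤
      (Real.sqrt (∑ m ∈ s, (r m * ε m) ^ 2) + Real.sqrt (∑ m ∈ s, r m ^ 2 * A m ^ 2 * (2 * N * (4 * d₀ m)))) ^ 2 := by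
  refine sum_le_sq_sqrt_add_sqrt s (fun m hm => mul_nonneg (hr m hm) (hε m hm))
    (fun m hm => by have := hr m hm; have := hA m hm; have := hd m hm; positivity) (fun m hm => le_of_eq ?_)
  have e : Real.sqrt (r m ^ 2 * A m ^ 2 * (2 * N * (4 * d₀ m))) = r m * A m * Real.sqrt (2 * N * (4 * d₀ m)) := by
    rw [show r m ^ 2 * A m ^ 2 * (2 * N * (4 * d₀ m)) = (r m * A m) ^ 2 * (2 * N * (4 * d₀ m)) by ring,
      Real.sqrt_mul (sq_nonneg _), Real.sqrt_sq (mul_nonneg (hr m hm) (hA m hm))]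
  rw [e]; ring

/-- **The envelope block sum with the canonical scales**: `d₀^m = 8τ_m/A_m + Mδ/(πN)` (`A_m, N > 0`, `τ_m, Mδ ≥ 0`) gives
`Σ_{m∈s} r_m²A_m²(2N·4d₀^m) = Σ_{m∈s} r_m²(64NA_mτ_m + 8A_m²Mδ/π)`. [folklore] -/
theorem sum_envelope_canonical_eq (s : Finset ℕ) {r A τ : ℕ → ℝ} {N Mδ : ℝ} (hA : ∀ m ∈ s, 0 < A m) (hN : 0 < N)
    (hτ : ∀ m ∈ s, 0 ≤ τ m) (hMδ : 0 ≤ Mδ) :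
    ∑ m ∈ s, r m ^ 2 * A m ^ 2 * (2 * N * (4 * (8 * τ m / A m + Mδ / (Real.pi * N)))) =
      ∑ m ∈ s, r m ^ 2 * (64 * N * A m * τ m + 8 * A m ^ 2 * Mδ / Real.pi) := by
  refine Finset.sum_congr rfl fun m hm => ?_
  have h := sq_envelope_canonical (hA m hm) hN (hτ m hm) hMδ
  have h0 : 0 ≤ 2 * N * (4 * (8 * τ m / A m + Mδ / (Real.pi * N))) := by
    have := hA m hm; have := hτ m hm; positivity
  rw [mul_pow, Real.sq_sqrt h0] at h
  rw [mul_assoc, h]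

/-- **The envelope block sum under UNIFORM constants**: `0 ≤ r_m ≤ r`, `0 < A_m ≤ A`, `0 ≤ τ_m ≤ τ₀/2^m` for all `m`
(`N, τ₀, Mδ ≥ 0`) give `Σ_{m<M} r_m²(64NA_mτ_m + 8A_m²Mδ/π) ≤ r²(128NAτ₀ + 8MA²Mδ/π)`. [folklore] -/
theorem sum_envelope_uniform_le {r A τ : ℕ → ℝ} {rs As τ₀ N Mδ : ℝ} (hN : 0 ≤ N) (hMδ : 0 ≤ Mδ) (hτ₀ : 0 ≤ τ₀)
    (hr0 : ∀ m, 0 ≤ r m) (hr : ∀ m, r m ≤ rs) (hA0 : ∀ m, 0 < A m) (hA : ∀ m, A m ≤ As)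
    (hτ0 : ∀ m, 0 ≤ τ m) (hτ : ∀ m, τ m ≤ τ₀ / 2 ^ m) (M : ℕ) :
    ∑ m ∈ range M, r m ^ 2 * (64 * N * A m * τ m + 8 * A m ^ 2 * Mδ / Real.pi) ≤
      rs ^ 2 * (128 * N * As * τ₀ + 8 * M * As ^ 2 * Mδ / Real.pi) := by
  have hπ : 0 < Real.pi := Real.pi_pos
  have hAs : 0 ≤ As := (hA0 0).le.trans (hA 0)
  have hterm : ∀ m ∈ range M, r m ^ 2 * (64 * N * A m * τ m + 8 * A m ^ 2 * Mδ / Real.pi) ≤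
      rs ^ 2 * (64 * N * As * τ₀ * (1 / 2) ^ m) + rs ^ 2 * (8 * As ^ 2 * Mδ / Real.pi) := by
    intro m _
    have hr2 : r m ^ 2 ≤ rs ^ 2 := pow_le_pow_left₀ (hr0 m) (hr m) 2
    have hA2 : A m ^ 2 ≤ As ^ 2 := pow_le_pow_left₀ (hA0 m).le (hA m) 2
    have h1 : A m * τ m ≤ As * (τ₀ / 2 ^ m) := mul_le_mul (hA m) (hτ m) (hτ0 m) hAs
    have h12 : 64 * N * A m * τ m + 8 * A m ^ 2 * Mδ / Real.pi ≤
        64 * N * As * τ₀ * (1 / 2) ^ m + 8 * As ^ 2 * Mδ / Real.pi := by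
      have h1' : 64 * N * (A m * τ m) ≤ 64 * N * (As * (τ₀ / 2 ^ m)) := mul_le_mul_of_nonneg_left h1 (by positivity)
      have h2' : 8 * (A m ^ 2 * Mδ) / Real.pi ≤ 8 * (As ^ 2 * Mδ) / Real.pi :=
        div_le_div_of_nonneg_right (by nlinarith [mul_le_mul_of_nonneg_right hA2 hMδ]) hπ.le
      have e1 : 64 * N * (As * (τ₀ / 2 ^ m)) = 64 * N * As * τ₀ * (1 / 2) ^ m := by rw [one_div, inv_pow]; ring
      calc 64 * N * A m * τ m + 8 * A m ^ 2 * Mδ / Real.pi = 64 * N * (A m * τ m) + 8 * (A m ^ 2 * Mδ) / Real.pi := by ring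
        _ ≤ 64 * N * (As * (τ₀ / 2 ^ m)) + 8 * (As ^ 2 * Mδ) / Real.pi := add_le_add h1' h2'
        _ = _ := by rw [e1]; ring
    have hR0 : 0 ≤ 64 * N * As * τ₀ * (1 / 2) ^ m + 8 * As ^ 2 * Mδ / Real.pi := by positivity
    calc r m ^ 2 * (64 * N * A m * τ m + 8 * A m ^ 2 * Mδ / Real.pi)
        ≤ r m ^ 2 * (64 * N * As * τ₀ * (1 / 2) ^ m + 8 * As ^ 2 * Mδ / Real.pi) := mul_le_mul_of_nonneg_left h12 (sq_nonneg _)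
      _ ≤ rs ^ 2 * (64 * N * As * τ₀ * (1 / 2) ^ m + 8 * As ^ 2 * Mδ / Real.pi) := mul_le_mul_of_nonneg_right hr2 hR0
      _ = _ := by ring
  refine (Finset.sum_le_sum hterm).trans ?_
  rw [Finset.sum_add_distrib, Finset.sum_const, Finset.card_range, nsmul_eq_mul, ← Finset.mul_sum, ← Finset.mul_sum]
  have hs := sum_range_half_pow_le M
  have hc : 0 ≤ 64 * N * As * τ₀ := by positivity
  have h1 : rs ^ 2 * (64 * N * As * τ₀ * ∑ m ∈ range M, (1 / 2 : ℝ) ^ m) ≤ rs ^ 2 * (128 * N * As * τ₀) :=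
    mul_le_mul_of_nonneg_left (by nlinarith [mul_le_mul_of_nonneg_left hs hc]) (sq_nonneg _)
  have e : (M : ℝ) * (rs ^ 2 * (8 * As ^ 2 * Mδ / Real.pi)) = rs ^ 2 * (8 * M * As ^ 2 * Mδ / Real.pi) := by ring
  rw [e]
  nlinarith

/-! ## §5 The SHARP closed form of the block sum (drop-in for `K1Window.blockJunk_sum_le`) -/

/-- **THE JUNK OF A FAMILY OF GEOMETRIC BLOCKS, SHARP FORM** (same hypotheses as `K1Window.blockJunk_sum_le`): for block constants
`0 ≤ r_m ≤ r*`, `0 < A_m ≤ A*`, `0 ≤ τ_m ≤ τ₀/2^m`, the canonical envelope scale `d₀^m = 8τ_m/A_m + Mδ/(πN)` (`N > 0`, `Mδ, τ₀ ≥ 0`)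
and rounding allowances `0 ≤ ε₀^m ≤ e₀·2^{m+1}`:
`Σ_{m<M_b} (r_m(ε₀^m + A_m√(2N·4d₀^m)))² ≤ (√((4/3)(r*e₀2^{M_b})²) + √(r*²(128·N·A*·τ₀ + 8·M_b·A*²·Mδ/π)))²` — Minkowski over the
blocks instead of `(a+b+c)² ≤ 3(a²+b²+c²)`: the kernel-layer and zone parts carry factor `1`, not `3`. [folklore] -/
theorem blockJunk_sum_le_sharp {r A τ ε₀ : ℕ → ℝ} {rs As τ₀ e₀ N Mδ : ℝ} (hN : 0 < N) (hMδ : 0 ≤ Mδ) (hτ₀ : 0 ≤ τ₀)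
    (hr0 : ∀ m, 0 ≤ r m) (hr : ∀ m, r m ≤ rs) (hA0 : ∀ m, 0 < A m) (hA : ∀ m, A m ≤ As)
    (hτ0 : ∀ m, 0 ≤ τ m) (hτ : ∀ m, τ m ≤ τ₀ / 2 ^ m) (hε0 : ∀ m, 0 ≤ ε₀ m) (hε : ∀ m, ε₀ m ≤ e₀ * 2 ^ (m + 1))
    (Mb : ℕ) :
    ∑ m ∈ range Mb, (r m * (ε₀ m + A m * Real.sqrt (2 * N * (4 * (8 * τ m / A m + Mδ / (Real.pi * N)))))) ^ 2 ≤
      (Real.sqrt (4 / 3 * (rs * e₀ * 2 ^ Mb) ^ 2) +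
        Real.sqrt (rs ^ 2 * (128 * N * As * τ₀ + 8 * Mb * As ^ 2 * Mδ / Real.pi))) ^ 2 := by
  have hd : ∀ m ∈ range Mb, 0 ≤ 2 * N * (4 * (8 * τ m / A m + Mδ / (Real.pi * N))) := fun m _ => by
    have := hA0 m; have := hτ0 m; positivity
  have h1 := sum_blockJunk_sq_le (range Mb) (N := N) (r := r) (ε := ε₀) (A := A)
    (d₀ := fun m => 8 * τ m / A m + Mδ / (Real.pi * N))
    (fun m _ => hr0 m) (fun m _ => hε0 m) (fun m _ => (hA0 m).le) hd
  have hrs : 0 ≤ rs := (hr0 0).trans (hr 0)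
  -- the rounding sum
  have hS1 : ∑ m ∈ range Mb, (r m * ε₀ m) ^ 2 ≤ 4 / 3 * (rs * e₀ * 2 ^ Mb) ^ 2 := by
    have hε2 : ∀ m, (r m * ε₀ m) ^ 2 ≤ rs ^ 2 * (e₀ ^ 2 * ((2 : ℝ) ^ (m + 1)) ^ 2) := fun m => by
      rw [← mul_pow, ← mul_pow]
      exact pow_le_pow_left₀ (mul_nonneg (hr0 m) (hε0 m)) (mul_le_mul (hr m) (hε m) (hε0 m) hrs) 2
    calc ∑ m ∈ range Mb, (r m * ε₀ m) ^ 2 ≤ ∑ m ∈ range Mb, rs ^ 2 * (e₀ ^ 2 * ((2 : ℝ) ^ (m + 1)) ^ 2) :=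
          Finset.sum_le_sum fun m _ => hε2 m
      _ = rs ^ 2 * (e₀ ^ 2 * ∑ m ∈ range Mb, ((2 : ℝ) ^ (m + 1)) ^ 2) := by rw [Finset.mul_sum, Finset.mul_sum]
      _ ≤ rs ^ 2 * (e₀ ^ 2 * (4 / 3 * ((2 : ℝ) ^ Mb) ^ 2)) :=
          mul_le_mul_of_nonneg_left (mul_le_mul_of_nonneg_left (sum_range_sq_two_pow_succ_le Mb) (sq_nonneg _)) (sq_nonneg _)
      _ = 4 / 3 * (rs * e₀ * 2 ^ Mb) ^ 2 := by ring
  -- the envelope sum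
  have hS2 : ∑ m ∈ range Mb, r m ^ 2 * A m ^ 2 * (2 * N * (4 * (8 * τ m / A m + Mδ / (Real.pi * N)))) ≤
      rs ^ 2 * (128 * N * As * τ₀ + 8 * Mb * As ^ 2 * Mδ / Real.pi) := by
    rw [sum_envelope_canonical_eq (range Mb) (fun m _ => hA0 m) hN (fun m _ => hτ0 m) hMδ]
    exact sum_envelope_uniform_le hN.le hMδ hτ₀ hr0 hr hA0 hA hτ0 hτ Mb
  refine h1.trans ?_
  have ha : Real.sqrt (∑ m ∈ range Mb, (r m * ε₀ m) ^ 2) ≤ Real.sqrt (4 / 3 * (rs * e₀ * 2 ^ Mb) ^ 2) :=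
    Real.sqrt_le_sqrt hS1
  have hb : Real.sqrt (∑ m ∈ range Mb, r m ^ 2 * A m ^ 2 * (2 * N * (4 * (8 * τ m / A m + Mδ / (Real.pi * N))))) ≤
      Real.sqrt (rs ^ 2 * (128 * N * As * τ₀ + 8 * Mb * As ^ 2 * Mδ / Real.pi)) := Real.sqrt_le_sqrt hS2
  exact pow_le_pow_left₀ (add_nonneg (Real.sqrt_nonneg _) (Real.sqrt_nonneg _)) (add_le_add ha hb) 2

/-- **Amplitude form of the sharp block sum**: under the hypotheses of `blockJunk_sum_le_sharp` (and `e₀ ≥ 0`),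
`√(Σ_{m<M_b} J_m²) ≤ (2/√3)·r*·e₀·2^{M_b} + r*·√(128·N·A*·τ₀ + 8·M_b·A*²·Mδ/π)` — the junk AMPLITUDE `w = √(ΣJ_m²)` that enters
`(w + √feed)²` in the energy ledger. [folklore] -/
theorem sqrt_blockJunk_sum_le_sharp {r A τ ε₀ : ℕ → ℝ} {rs As τ₀ e₀ N Mδ : ℝ} (hN : 0 < N) (hMδ : 0 ≤ Mδ) (hτ₀ : 0 ≤ τ₀)
    (he₀ : 0 ≤ e₀)
    (hr0 : ∀ m, 0 ≤ r m) (hr : ∀ m, r m ≤ rs) (hA0 : ∀ m, 0 < A m) (hA : ∀ m, A m ≤ As)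
    (hτ0 : ∀ m, 0 ≤ τ m) (hτ : ∀ m, τ m ≤ τ₀ / 2 ^ m) (hε0 : ∀ m, 0 ≤ ε₀ m) (hε : ∀ m, ε₀ m ≤ e₀ * 2 ^ (m + 1))
    (Mb : ℕ) :
    Real.sqrt (∑ m ∈ range Mb, (r m * (ε₀ m + A m * Real.sqrt (2 * N * (4 * (8 * τ m / A m + Mδ / (Real.pi * N)))))) ^ 2) ≤
      2 / Real.sqrt 3 * rs * e₀ * 2 ^ Mb + rs * Real.sqrt (128 * N * As * τ₀ + 8 * Mb * As ^ 2 * Mδ / Real.pi) := by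
  have h := blockJunk_sum_le_sharp hN hMδ hτ₀ hr0 hr hA0 hA hτ0 hτ hε0 hε Mb
  have hrs : 0 ≤ rs := (hr0 0).trans (hr 0)
  have hAs : 0 ≤ As := (hA0 0).le.trans (hA 0)
  have h0 : 0 ≤ Real.sqrt (4 / 3 * (rs * e₀ * 2 ^ Mb) ^ 2) +
      Real.sqrt (rs ^ 2 * (128 * N * As * τ₀ + 8 * Mb * As ^ 2 * Mδ / Real.pi)) :=
    add_nonneg (Real.sqrt_nonneg _) (Real.sqrt_nonneg _)
  have h1 := Real.sqrt_le_sqrt h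
  rw [Real.sqrt_sq h0] at h1
  refine h1.trans (le_of_eq ?_)
  have h3 : (0 : ℝ) < Real.sqrt 3 := Real.sqrt_pos.mpr (by norm_num)
  have e1 : Real.sqrt (4 / 3 * (rs * e₀ * 2 ^ Mb) ^ 2) = 2 / Real.sqrt 3 * rs * e₀ * 2 ^ Mb := by
    have hx : 0 ≤ rs * e₀ * 2 ^ Mb := by positivity
    rw [Real.sqrt_mul (by norm_num), Real.sqrt_sq hx, Real.sqrt_div' _ (by norm_num : (0 : ℝ) ≤ 3),
      show Real.sqrt 4 = 2 by rw [show (4 : ℝ) = 2 ^ 2 by norm_num, Real.sqrt_sq (by norm_num)]]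
    ring
  have e2 : Real.sqrt (rs ^ 2 * (128 * N * As * τ₀ + 8 * Mb * As ^ 2 * Mδ / Real.pi)) =
      rs * Real.sqrt (128 * N * As * τ₀ + 8 * Mb * As ^ 2 * Mδ / Real.pi) := by
    rw [Real.sqrt_mul (sq_nonneg _), Real.sqrt_sq hrs]
  rw [e1, e2]

/-- **Young split of the sharp block sum**: for any `t > 0`, under the hypotheses of `blockJunk_sum_le_sharp`,
`Σ_{m<M_b} J_m² ≤ (1 + t)·r*²(128·N·A*·τ₀ + 8·M_b·A*²·Mδ/π) + (1 + 1/t)·(4/3)(r*e₀2^{M_b})²` — the additive form for the energy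
ledger (`t` small once the rounding allowance `e₀` is negligible). [folklore] -/
theorem blockJunk_sum_le_young {r A τ ε₀ : ℕ → ℝ} {rs As τ₀ e₀ N Mδ : ℝ} (hN : 0 < N) (hMδ : 0 ≤ Mδ) (hτ₀ : 0 ≤ τ₀)
    (hr0 : ∀ m, 0 ≤ r m) (hr : ∀ m, r m ≤ rs) (hA0 : ∀ m, 0 < A m) (hA : ∀ m, A m ≤ As)
    (hτ0 : ∀ m, 0 ≤ τ m) (hτ : ∀ m, τ m ≤ τ₀ / 2 ^ m) (hε0 : ∀ m, 0 ≤ ε₀ m) (hε : ∀ m, ε₀ m ≤ e₀ * 2 ^ (m + 1))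
    (Mb : ℕ) {t : ℝ} (ht : 0 < t) :
    ∑ m ∈ range Mb, (r m * (ε₀ m + A m * Real.sqrt (2 * N * (4 * (8 * τ m / A m + Mδ / (Real.pi * N)))))) ^ 2 ≤
      (1 + t) * (rs ^ 2 * (128 * N * As * τ₀ + 8 * Mb * As ^ 2 * Mδ / Real.pi)) +
        (1 + 1 / t) * (4 / 3 * (rs * e₀ * 2 ^ Mb) ^ 2) := by
  have h := blockJunk_sum_le_sharp hN hMδ hτ₀ hr0 hr hA0 hA hτ0 hτ hε0 hε Mb
  have hAs : 0 ≤ As := (hA0 0).le.trans (hA 0)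
  set a := 4 / 3 * (rs * e₀ * 2 ^ Mb) ^ 2 with ha
  set b := rs ^ 2 * (128 * N * As * τ₀ + 8 * Mb * As ^ 2 * Mδ / Real.pi) with hb
  have ha0 : 0 ≤ a := by positivity
  have hb0 : 0 ≤ b := by positivity
  refine h.trans ?_
  -- `(√a + √b)² = a + b + 2√a√b ≤ a + b + a/t + t·b`
  have hab : 2 * Real.sqrt a * Real.sqrt b ≤ a / t + t * b := by
    have key : 0 ≤ (Real.sqrt a - t * Real.sqrt b) ^ 2 := sq_nonneg _
    have e : (Real.sqrt a - t * Real.sqrt b) ^ 2 = a - 2 * t * (Real.sqrt a * Real.sqrt b) + t ^ 2 * b := by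
      rw [sub_sq, mul_pow, Real.sq_sqrt ha0, Real.sq_sqrt hb0]; ring
    rw [e] at key
    have h2 : 2 * t * (Real.sqrt a * Real.sqrt b) ≤ a + t ^ 2 * b := by linarith
    have e2 : a / t + t * b = (a + t ^ 2 * b) / t := by field_simp
    rw [e2, le_div_iff₀ ht]
    nlinarith
  calc (Real.sqrt a + Real.sqrt b) ^ 2 = a + b + 2 * Real.sqrt a * Real.sqrt b := by
        rw [add_sq, Real.sq_sqrt ha0, Real.sq_sqrt hb0]; ring
    _ ≤ a + b + (a / t + t * b) := by linarith
    _ = (1 + t) * b + (1 + 1 / t) * a := by ring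

/-! ## §6 Phase sums -/

/-- **`4^{M_b}` for the canonical block count of `…BlockBudget`**: `(2^{M_b})² ≤ (2x/(Λ₀√f) + 2)²`
(`M_b := Nat.clog 2 ⌈x/(Λ₀√f)⌉₊`, `Λ₀ ≥ 1`, `x ≥ 0`) — controls the rounding part `(r*e₀2^{M_b})²`. [folklore] -/
theorem sq_two_pow_clog_le {x f : ℝ} {Λ₀ : ℕ} (hΛ₀ : 1 ≤ Λ₀) (hx : 0 ≤ x) :
    ((2 : ℝ) ^ Nat.clog 2 ⌈x / (Λ₀ * Real.sqrt f)⌉₊) ^ 2 ≤ (2 * (x / (Λ₀ * Real.sqrt f)) + 2) ^ 2 :=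
  pow_le_pow_left₀ (by positivity) (two_pow_clog_le (f := f) hΛ₀ hx) 2

/-- **The geometric envelope block sum** (the shape asked for by the assembly): `Σ_{m<M} 64·r²·N·A·(τ₀/2^m) ≤ 128·r²·N·A·τ₀`
(`N, A, τ₀ ≥ 0`). [folklore] -/
theorem sum_range_envelope_geometric_le {r N A τ₀ : ℝ} (hN : 0 ≤ N) (hA : 0 ≤ A) (hτ₀ : 0 ≤ τ₀) (M : ℕ) :
    ∑ m ∈ range M, 64 * r ^ 2 * N * A * (τ₀ / 2 ^ m) ≤ 128 * r ^ 2 * N * A * τ₀ := by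
  have e : ∀ m : ℕ, 64 * r ^ 2 * N * A * (τ₀ / 2 ^ m) = (64 * r ^ 2 * N * A * τ₀) * (1 / 2 : ℝ) ^ m := fun m => by
    rw [one_div, inv_pow]; ring
  simp_rw [e]
  rw [← Finset.mul_sum]
  have hc : 0 ≤ 64 * r ^ 2 * N * A * τ₀ := by positivity
  nlinarith [mul_le_mul_of_nonneg_left (sum_range_half_pow_le M) hc]

/-- **Affine–geometric series** (the phase sum of the `δ`-linear parts, `#blocks ≤ a + b·i`):
`Σ_i (a + b·i)θ^i = a/(1−θ) + bθ/(1−θ)²` for `0 ≤ θ < 1`. [folklore] -/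
theorem hasSum_affine_mul_geometric {a b θ : ℝ} (hθ0 : 0 ≤ θ) (hθ1 : θ < 1) :
    HasSum (fun i : ℕ => (a + b * i) * θ ^ i) (a / (1 - θ) + b * (θ / (1 - θ) ^ 2)) := by
  have hθn : ‖θ‖ < 1 := by rw [Real.norm_eq_abs, abs_lt]; exact ⟨by linarith, hθ1⟩
  have h1 : HasSum (fun i : ℕ => a * θ ^ i) (a / (1 - θ)) := by
    have := (hasSum_geometric_of_lt_one hθ0 hθ1).mul_left a
    rwa [div_eq_mul_inv]
  have h2 : HasSum (fun i : ℕ => b * (i * θ ^ i)) (b * (θ / (1 - θ) ^ 2)) :=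
    (hasSum_coe_mul_geometric_of_norm_lt_one hθn).mul_left b
  convert h1.add h2 using 1
  funext i; ring

/-- **Summing an affine–geometric majorant**: `0 ≤ e_i ≤ (a + b·i)θ^i` (`0 ≤ θ < 1`) gives `e` summable and
`Σ'_i e_i ≤ a/(1−θ) + bθ/(1−θ)²` — the `hes`/budget inputs of `K1Ledger.From.k1Localised_of_class_energy_ledger` for junk
energies whose block count grows affinely in the phase. [folklore] -/
theorem tsum_le_of_le_affine_mul_geometric {e : ℕ → ℝ} {a b θ : ℝ} (hθ0 : 0 ≤ θ) (hθ1 : θ < 1) (he0 : ∀ i, 0 ≤ e i)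
    (he : ∀ i, e i ≤ (a + b * i) * θ ^ i) :
    Summable e ∧ ∑' i, e i ≤ a / (1 - θ) + b * (θ / (1 - θ) ^ 2) := by
  have hS := hasSum_affine_mul_geometric (a := a) (b := b) hθ0 hθ1
  have hs : Summable e := Summable.of_nonneg_of_le he0 he hS.summable
  exact ⟨hs, hS.tsum_eq ▸ hs.tsum_le_tsum he hS.summable⟩

/-- **Shifted geometric comparison** (phase ratios): `N ≤ N₀·ρ^j` and `c·g^j ≤ Λ` with `N₀, c, g > 0`, `ρ ≥ 0` give
`N/Λ ≤ (N₀/c)·(ρ/g)^j` — e.g. the kernel-layer term `128r²N_jAτ₀(j) ∝ N_j/Λ₀(j)` decays like `(ρ_N/(γ²−3))^j`. [folklore] -/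
theorem div_le_mul_pow_of_le {N Λ N₀ c ρ g : ℝ} {j : ℕ} (hN₀ : 0 < N₀) (hc : 0 < c) (hρ : 0 ≤ ρ) (hg : 0 < g)
    (hN : N ≤ N₀ * ρ ^ j) (hΛ : c * g ^ j ≤ Λ) : N / Λ ≤ N₀ / c * (ρ / g) ^ j := by
  have hgj : 0 < g ^ j := pow_pos hg j
  have hΛ0 : 0 < Λ := lt_of_lt_of_le (mul_pos hc hgj) hΛ
  rw [div_le_iff₀ hΛ0, div_pow]
  calc N ≤ N₀ * ρ ^ j := hN
    _ = N₀ / c * (ρ ^ j / g ^ j) * (c * g ^ j) := by field_simp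
    _ ≤ N₀ / c * (ρ ^ j / g ^ j) * Λ := mul_le_mul_of_nonneg_left hΛ (by positivity)

end Summit.AnomalousDissipation.AnomalousDissipation.Theorems.SawtoothPulseCascade.K1Window
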